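import Summits.PneNP.PneNP.Theorems.NegLimitedHalfWindowSlicesLang
import Summits.PneNP.PneNP.Theorems.NegLimitedHalfWindowSlicesEval
import Mathlib
import HarnessLib

/-!
# Route NegLimited — line `half-window`, stub `stub_halfSlicesNP` (rung F-N1/p3, ROUND-13)

Registered stub (S′) of the skeleton `half-window` on the rung item `NegLimited.NeglimitedHalfLogNegationsR`
(stmt-PneNP-19888; HOME/pnp-ideate-p3/r13/half-window.lean; card r13/half-window.md): `HalfSlicesNP` — ONE
language `L ∈ NP` whose slice at every length `halfLen n kc r = 2^{pair r kc}·(2·hP·n² + 1)` (`3 ≤ kc < n`,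
`1 ≤ r`) is monotone and inherits every negation-limited De Morgan lower bound proved for
`halfFn n kc r = TRIBES_{w,m} ∘ RM3_d ∘ CLIQUE(n,kc)` on `hP = m·w·3^d` graph blocks.

The witness is `HalfSlices.halfLang` (`…SlicesVerifier.lean` + `…SlicesLang.lean`: verifier `verdict ∈ FP`,
`halfLang ∈ NP`; `…SlicesEval.lean`: the length pins the parameters, closed form `halfSlice`).  Here:
* `sliceFn_halfLang`: the slice at `halfLen n kc r` is `halfSlice n kc r` (soundness: marked `kc`-sets are
  cliques, `RM3` and `TRIBES` are monotone, the verifier's rounds evaluate `RM3_d` by the door's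
  `rounds_eval`; completeness: mark a `kc`-clique in every block that has one, certificate `cert` with the true
  parameters, `|cert| ≤ 20·N + 20`);
* the input retraction `halfRetract` (position ↦ (block, edge) through the block numbering `hIdx`) with
  `sliceFn (y ∘ halfRetract) = halfFn n kc r y`, nonemptiness of the admissible class
  (`exists_monotone_circuit`), and the transfer `NegLimSlices.le_negLimitedSizeOver_of_retract`;
* `theorem stub_halfSlicesNP : HalfSlicesNP`.

References: S. Arora, B. Barak, *Computational Complexity* (2009), §2.1 Ex. 2.2, §6.1 [AroraBarakCC2009];
R. O'Donnell, JCSS 69 (2004), §1 [ODonnell2004].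

HONEST FRAMING: `NP`-membership and slice plumbing for stub S′; the rung item is NOT closed by this file;
FRONTIER rung F-N1 — nothing here bears on P vs NP.
-/

set_option linter.dupNamespace false -- `Summit.PneNP.PneNP.…`: summit = sub-problem name (D-0017 single-conjunct layout)

namespace Summit.PneNP.PneNP.Theorems.NegLimitedHalfWindow

open Finset
open Literature.Computability.Complexity Literature.Barriers.PneNP
open Summit.PneNP.PneNP.Theorems.NegLimSlices
open Summit.PneNP.PneNP.Theorems.NegLimitedAmplifiedWindow (Edge recMaj3 recMaj3_monotone rounds_eval)
open Summit.PneNP.PneNP.Theorems.NegLimitedAmplifiedWindow.SlicesNP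
  (blockBit blockBit_eq_true_iff markCount markCount_eq_card rounds)
open HalfSlices
variable {n kc r : ℕ}

/-! ### The verifier's RM3 values on an honest-length input -/

/-- `3^d ≤ hP ≤ halfLen`. -/
theorem three_pow_le_halfLen (hr : 1 ≤ r) (hn : 2 ≤ n) : 3 ^ dCal (wOf n r) ≤ halfLen n kc r := by
  have hw := one_le_wOf hr hn
  have hm := one_le_mCal hw
  have h1 : 3 ^ dCal (wOf n r) ≤ hP n r := by
    unfold hP
    calc 3 ^ dCal (wOf n r) = 1 * 1 * 3 ^ dCal (wOf n r) := by ring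
      _ ≤ mCal (wOf n r) * wOf n r * 3 ^ dCal (wOf n r) := Nat.mul_le_mul_right _ (Nat.mul_le_mul hm hw)
  have h2 : hP n r ≤ halfLen n kc r := by
    unfold halfLen
    have h3 : hP n r ≤ 2 * (hP n r * n ^ 2) + 1 := by nlinarith [Nat.one_le_pow 2 n (by omega)]
    exact h3.trans (Nat.le_mul_of_pos_left _ (Nat.two_pow_pos _))
  exact h1.trans h2

/-- The certificate length budget: all nine unary fields and the mark string fit in `20·N + 20`. -/
theorem cert_budget_le (hkn : kc < n) (hr : 1 ≤ r) (hn2 : 2 ≤ n) :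
    2 * (n + kc + r + Nat.log 2 n + Nat.log 2 (wOf n r) + Nat.pair r kc + wOf n r + mCal (wOf n r) +
      dCal (wOf n r)) + 18 + hP n r * n ≤ 20 * halfLen n kc r + 20 := by
  have hw1 : 1 ≤ wOf n r := one_le_wOf hr hn2
  have hm1 : 1 ≤ mCal (wOf n r) := one_le_mCal hw1
  have hN := le_halfLen (kc := kc) hr hn2
  have hsq : 1 ≤ n ^ 2 := Nat.one_le_pow 2 n (by omega)
  have hPN : hP n r ≤ halfLen n kc r := by
    unfold halfLen
    have h3 : hP n r ≤ 2 * (hP n r * n ^ 2) + 1 := by nlinarith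
    exact h3.trans (Nat.le_mul_of_pos_left _ (Nat.two_pow_pos _))
  have hTN : hP n r * n ≤ halfLen n kc r := by
    unfold halfLen
    have h4 : n ≤ n ^ 2 := by nlinarith
    have h3 : hP n r * n ≤ 2 * (hP n r * n ^ 2) + 1 := by nlinarith
    exact h3.trans (Nat.le_mul_of_pos_left _ (Nat.two_pow_pos _))
  have hL : Nat.log 2 n ≤ n := Nat.log_le_self 2 n
  have hwP : wOf n r ≤ hP n r := by
    unfold hP
    calc wOf n r = 1 * wOf n r * 1 := by ring
      _ ≤ mCal (wOf n r) * wOf n r * 3 ^ dCal (wOf n r) :=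
          Nat.mul_le_mul (Nat.mul_le_mul_right _ hm1) (Nat.one_le_pow _ _ (by norm_num))
  have hrw : r ≤ wOf n r := by
    unfold wOf
    have : 1 ≤ Nat.log 2 n := Nat.le_log_of_pow_le (by norm_num) (by simpa using hn2)
    nlinarith
  have hLw : Nat.log 2 (wOf n r) ≤ wOf n r := Nat.log_le_self 2 _
  have hPP : Nat.pair r kc ≤ halfLen n kc r := by
    unfold halfLen
    exact (Nat.lt_two_pow_self).le.trans (Nat.le_mul_of_pos_right _ (by omega))
  have hmP : mCal (wOf n r) ≤ hP n r := by
    unfold hP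
    calc mCal (wOf n r) = mCal (wOf n r) * 1 * 1 := by ring
      _ ≤ mCal (wOf n r) * wOf n r * 3 ^ dCal (wOf n r) :=
          Nat.mul_le_mul (Nat.mul_le_mul_left _ hw1) (Nat.one_le_pow _ _ (by norm_num))
  have hdP : dCal (wOf n r) ≤ hP n r := by
    have h1 : dCal (wOf n r) ≤ 3 ^ dCal (wOf n r) := (Nat.lt_pow_self (by norm_num)).le
    unfold hP
    calc dCal (wOf n r) ≤ 3 ^ dCal (wOf n r) := h1
      _ = 1 * 1 * 3 ^ dCal (wOf n r) := by ring
      _ ≤ mCal (wOf n r) * wOf n r * 3 ^ dCal (wOf n r) := Nat.mul_le_mul_right _ (Nat.mul_le_mul hm1 hw1)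
  omega

/-- With consistent parameters the verifier's `rmVal t` IS `RM3_d` of the block bits `ffe u + 3^d·t`. -/
theorem rmVal_ofFn (x : Fin (halfLen n kc r) → Bool) {y : List Bool} (hN : pN y = n) (hK : pK y = kc)
    (hD : pD y = dCal (wOf n r)) (h3 : 3 ^ dCal (wOf n r) ≤ halfLen n kc r) (t : ℕ) :
    rmVal (List.ofFn x) y t = recMaj3 (dCal (wOf n r)) (fun u => blockBit (List.ofFn x) (pT y) n kc
      ((finFunctionFinEquiv u : ℕ) + 3 ^ dCal (wOf n r) * t)) := by
  unfold rmVal levStr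
  rw [List.length_ofFn, hD, hN, hK, min_eq_left h3, rounds_eval]
  simp

/-! ### The slice at `halfLen n kc r` -/

/-- **The slice of `halfLang` at length `halfLen n kc r`** (`3 ≤ kc < n`, `1 ≤ r`) is `halfSlice n kc r`. -/
theorem sliceFn_halfLang (hk : 3 ≤ kc) (hkn : kc < n) (hr : 1 ≤ r) (x : Fin (halfLen n kc r) → Bool) :
    halfLang.sliceFn (halfLen n kc r) x = halfSlice n kc r x := by
  classical
  have hn2 : 2 ≤ n := by omega
  have hw1 : 1 ≤ wOf n r := one_le_wOf hr hn2
  have hm1 : 1 ≤ mCal (wOf n r) := one_le_mCal hw1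
  have hP1 : 1 ≤ hP n r := one_le_hP hr hn2
  have hu : (List.ofFn x).length = halfLen n kc r := by simp
  have hmem : halfLang.boolIndicator (List.ofFn x) = true ↔
      ∃ y : List Bool, y.length ≤ 20 * (List.ofFn x).length + 20 ∧ verdict (List.ofFn x, y) = true := by
    rw [← Set.mem_iff_boolIndicator]
    exact mem_halfLang
  rw [Bool.eq_iff_iff]
  change halfLang.boolIndicator (List.ofFn x) = true ↔ _
  rw [hmem, hu]
  constructor
  · -- soundness
    rintro ⟨y, -, hv⟩
    obtain ⟨hc, htv⟩ := verdict_eq_true_iff.1 hv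
    obtain ⟨hN, hK, -, hW, hM, hD⟩ := params_of_checks hk hkn hr hu hc
    rw [tribesVal_eq_true_iff, hM, hW] at htv
    obtain ⟨j, hj, hall⟩ := htv
    unfold halfSlice tribes
    rw [decide_eq_true_iff]
    refine ⟨⟨j, hj⟩, fun i => ?_⟩
    have hi := hall i i.2
    rw [rmVal_ofFn x hN hK hD (three_pow_le_halfLen hr hn2)] at hi
    have hle : recMaj3 (dCal (wOf n r)) (fun u => blockBit (List.ofFn x) (pT y) n kc
        ((finFunctionFinEquiv u : ℕ) + 3 ^ dCal (wOf n r) * ((i : ℕ) + wOf n r * j))) ≤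
        recMaj3 (dCal (wOf n r)) (fun u => cliqueFn n kc (edgeVec (blockVec x (hIdx n r ((⟨j, hj⟩, i), u))))) :=
      recMaj3_monotone _ fun u => by
        have hidx : (finFunctionFinEquiv u : ℕ) + 3 ^ dCal (wOf n r) * ((i : ℕ) + wOf n r * j) =
            ((hIdx n r ((⟨j, hj⟩, i), u) : Fin (hP n r)) : ℕ) := by rw [hIdx_val]
        rw [hidx]
        by_cases hb : blockBit (List.ofFn x) (pT y) n kc (hIdx n r ((⟨j, hj⟩, i), u) : Fin (hP n r)) = true
        · rw [hb, clique_of_blockBit' x (pT y) _ hb]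
        · rw [Bool.not_eq_true] at hb; rw [hb]; exact Bool.false_le _
    rw [hi] at hle
    exact top_le_iff.1 hle
  · -- completeness: mark a `kc`-clique in every block that has one
    intro hx
    have hS : ∀ β : Fin (hP n r), ∃ S : Finset (Fin n), cliqueFn n kc (edgeVec (blockVec x β)) = true →
        S.card = kc ∧ ∀ a ∈ S, ∀ b ∈ S, a < b → ∀ h : (b : ℕ) + n * (a : ℕ) < n * n,
          blockVec x β ⟨(b : ℕ) + n * (a : ℕ), h⟩ = true := by
      intro β
      by_cases h : cliqueFn n kc (edgeVec (blockVec x β)) = true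
      · obtain ⟨S, hS⟩ := (cliqueFn_edgeVec_iff kc (blockVec x β)).1 h
        exact ⟨S, fun _ => hS⟩
      · exact ⟨∅, fun h' => absurd h' h⟩
    choose S hS using hS
    -- the mark predicate and the mark string
    set mark : ℕ → ℕ → Bool := fun β' v => decide (∃ hβ : β' < hP n r, ∃ hv : v < n,
      cliqueFn n kc (edgeVec (blockVec x ⟨β', hβ⟩)) = true ∧ (⟨v, hv⟩ : Fin n) ∈ S ⟨β', hβ⟩) with hmark
    set T : List Bool := (List.range (hP n r * n)).map fun idx => mark (idx / n) (idx % n) with hT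
    have hTget : ∀ {β' v : ℕ}, β' < hP n r → v < n → T.getD (β' * n + v) false = mark β' v := by
      intro β' v hβ hv
      have hi : β' * n + v < hP n r * n := by
        calc β' * n + v < β' * n + n := by omega
          _ = (β' + 1) * n := by ring
          _ ≤ hP n r * n := Nat.mul_le_mul_right _ hβ
      rw [hT, List.getD_eq_getElem?_getD, List.getElem?_map, List.getElem?_range hi, Option.map_some,
        Option.getD_some]
      have hn' : 0 < n := by omega
      rw [Nat.add_comm, Nat.add_mul_div_right _ _ hn', Nat.div_eq_of_lt hv, zero_add, Nat.add_mul_mod_self_right,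
        Nat.mod_eq_of_lt hv]
    -- the block bits of the honest certificate are the clique indicators
    have hbits : ∀ β : Fin (hP n r),
        blockBit (List.ofFn x) T n kc β = cliqueFn n kc (edgeVec (blockVec x β)) := by
      intro β
      have hβ := β.2
      have hmarked : ∀ v : Fin n, T.getD ((β : ℕ) * n + v) false = true ↔
          cliqueFn n kc (edgeVec (blockVec x β)) = true ∧ v ∈ S β := by
        intro v
        rw [hTget hβ v.2]
        simp only [hmark, decide_eq_true_iff]
        constructor
        · rintro ⟨_, _, h1, h2⟩; exact ⟨h1, h2⟩
        · rintro ⟨h1, h2⟩; exact ⟨hβ, v.2, h1, h2⟩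
      have hcount : markCount T n β =
          (univ.filter fun v : Fin n => cliqueFn n kc (edgeVec (blockVec x β)) = true ∧ v ∈ S β).card := by
        rw [markCount_eq_card, ← card_filter_univ_fin n fun v => T.getD ((β : ℕ) * n + v) false = true]
        congr 1
        ext v
        simp only [mem_filter, mem_univ, true_and, hmarked v]
      by_cases hcl : cliqueFn n kc (edgeVec (blockVec x β)) = true
      · obtain ⟨hcard, hpairs⟩ := hS β hcl
        rw [hcl, blockBit_eq_true_iff, hcount]
        refine ⟨?_, fun a b ha hb hab hTa hTb => ?_⟩
        · calc _ = (S β).card := by congr 1; ext v; simp [hcl]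
            _ = kc := hcard
        · have ha' := (hmarked ⟨a, ha⟩).1 hTa
          have hb' := (hmarked ⟨b, hb⟩).1 hTb
          have hlt : b + n * a < n * n :=
            calc b + n * a < n + n * a := Nat.add_lt_add_right hb _
              _ = n * (a + 1) := by ring
              _ ≤ n * n := Nat.mul_le_mul_left _ ha
          rw [getD_ofFn_block' x β hlt]
          exact hpairs _ ha'.2 _ hb'.2 hab hlt
      · rw [Bool.not_eq_true] at hcl
        rw [hcl, Bool.eq_false_iff, Ne, blockBit_eq_true_iff, hcount, not_and]
        intro hcard
        exfalso
        have : (univ.filter fun v : Fin n => cliqueFn n kc (edgeVec (blockVec x β)) = true ∧ v ∈ S β) = ∅ := by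
          ext v; simp [hcl]
        rw [this, card_empty] at hcard
        have h0 : kc = 0 := hcard.symm
        rw [h0] at hk
        exact absurd hk (by decide)
    -- the certificate with the true parameters
    refine ⟨cert n kc r (Nat.log 2 n) (Nat.log 2 (wOf n r)) (Nat.pair r kc) (wOf n r) (mCal (wOf n r))
      (dCal (wOf n r)) T, ?_, ?_⟩
    · -- length budget `≤ 20·N + 20`
      have hTlen : T.length = hP n r * n := by simp [hT]
      rw [length_cert, hTlen]
      exact cert_budget_le hkn hr hn2
    · rw [verdict_eq_true_iff, checks_eq_true_iff, tribesVal_eq_true_iff]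
      simp only [pN_cert, pK_cert, pR_cert, pL_cert, pLw_cert, pP_cert, pW_cert, pM_cert, pD_cert]
      refine ⟨⟨hk, hkn, hr, Nat.pow_log_le_self 2 (by omega), Nat.lt_pow_succ_log_self (by norm_num) n, rfl,
        Nat.pow_log_le_self 2 (by omega), Nat.lt_pow_succ_log_self (by norm_num) _, trivial, ?_, ?_, rfl, ?_⟩,
        ?_⟩
      · rw [mSumQ_eq]; exact Nat.floor_le (Finset.sum_nonneg fun j _ => by positivity)
      · rw [mSumQ_eq]; exact Nat.lt_floor_add_one _
      · rw [hu]; unfold halfLen hP; rw [pow_two]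
      · -- the tribes of the honest certificate
        unfold halfSlice tribes at hx
        rw [decide_eq_true_iff] at hx
        obtain ⟨j, hj⟩ := hx
        refine ⟨j, j.2, fun i hi => ?_⟩
        rw [rmVal_ofFn x (pN_cert ..) (pK_cert ..) (pD_cert ..) (three_pow_le_halfLen hr hn2)]
        have hji := hj ⟨i, hi⟩
        have hfun : (fun u => blockBit (List.ofFn x) T n kc
            ((finFunctionFinEquiv u : ℕ) + 3 ^ dCal (wOf n r) * (i + wOf n r * (j : ℕ)))) =
            fun u => cliqueFn n kc (edgeVec (blockVec x (hIdx n r ((j, ⟨i, hi⟩), u)))) := by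
          funext u
          have hidx : (finFunctionFinEquiv u : ℕ) + 3 ^ dCal (wOf n r) * (i + wOf n r * (j : ℕ)) =
              ((hIdx n r ((j, ⟨i, hi⟩), u) : Fin (hP n r)) : ℕ) := by rw [hIdx_val]
          rw [hidx, hbits]
        rw [pT_cert, hfun]
        exact hji

/-- The slices at the lengths `halfLen n kc r` are monotone. -/
theorem monotone_sliceFn_halfLang (hk : 3 ≤ kc) (hkn : kc < n) (hr : 1 ≤ r) :
    Monotone (halfLang.sliceFn (halfLen n kc r)) := by
  intro x x' h
  rw [sliceFn_halfLang hk hkn hr, sliceFn_halfLang hk hkn hr]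
  exact halfSlice_monotone n kc r h

/-! ### The input retraction and the transfer -/

/-- The input retraction: position `β n² + t` ↦ (block `hIdx⁻¹ β`, edge of matrix position `t`); padding
positions wrap around harmlessly. -/
noncomputable def halfRetract (hn : 2 ≤ n) (hr : 1 ≤ r) (p : Fin (halfLen n kc r)) : HBlk n r × Edge n :=
  ((hIdx n r).symm ⟨(p : ℕ) / (n * n) % hP n r, Nat.mod_lt _ (one_le_hP hr hn)⟩,
    edgeOfPos ⟨s(⟨0, by omega⟩, ⟨1, by omega⟩), by simp [Fin.ext_iff]⟩
      ⟨(p : ℕ) % (n * n), Nat.mod_lt _ (by nlinarith)⟩)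

/-- Pulling back along the retraction, block `β` reads `y (hIdx⁻¹ β, ·)` through `edgeOfPos`. -/
theorem blockVec_comp_halfRetract (hn : 2 ≤ n) (hr : 1 ≤ r) (y : HBlk n r × Edge n → Bool)
    (β : Fin (hP n r)) :
    blockVec (fun p : Fin (halfLen n kc r) => y (halfRetract hn hr p)) β = fun t =>
      y ((hIdx n r).symm β, edgeOfPos ⟨s(⟨0, by omega⟩, ⟨1, by omega⟩), by simp [Fin.ext_iff]⟩ t) := by
  funext t
  have hnn : 0 < n * n := by nlinarith
  have hβ := β.2
  simp only [blockVec, halfRetract]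
  have hq : ((β : ℕ) * (n * n) + t) / (n * n) % hP n r = (β : ℕ) := by
    rw [Nat.add_comm, Nat.add_mul_div_right _ _ hnn, Nat.div_eq_of_lt t.2, zero_add, Nat.mod_eq_of_lt hβ]
  have hrem : ((β : ℕ) * (n * n) + t) % (n * n) = t := by
    rw [Nat.add_comm, Nat.add_mul_mod_self_right, Nat.mod_eq_of_lt t.2]
  congr 1
  · rw [Prod.mk.injEq]
    refine ⟨?_, ?_⟩
    · congr 1
      exact Fin.ext hq
    · congr 1
      exact Fin.ext hrem

/-- **The slice pulls back to `halfFn n kc r`** along the retraction. -/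
theorem sliceFn_comp_halfRetract (hk : 3 ≤ kc) (hkn : kc < n) (hr : 1 ≤ r) (y : HBlk n r × Edge n → Bool) :
    halfLang.sliceFn (halfLen n kc r) (fun p : Fin (halfLen n kc r) => y (halfRetract (by omega) hr p)) =
      halfFn n kc r y := by
  rw [sliceFn_halfLang hk hkn hr]
  unfold halfSlice halfFn tribesRM3
  congr 1
  funext ji
  congr 1
  funext u
  rw [blockVec_comp_halfRetract, Equiv.symm_apply_apply, edgeVec_comp_edgeOfPos _ (fun e => y ((ji, u), e))]

/-- **Registered stub `stub_halfSlicesNP`** of the skeleton `half-window` (stmt-PneNP-19888): the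
`TRIBES ∘ RM3 ∘ CLIQUE` language is in `NP`, its slices at the lengths `halfLen n kc r` (`3 ≤ kc < n`, `1 ≤ r`)
are monotone and inherit every negation-limited De Morgan lower bound of `halfFn n kc r`. -/
theorem stub_halfSlicesNP : HalfSlicesNP := by
  classical
  refine ⟨halfLang, halfLang_mem_NP, fun n kc r hk hkn hr => ⟨monotone_sliceFn_halfLang hk hkn hr, ?_⟩⟩
  intro b s hlow
  have hn2 : 2 ≤ n := by omega
  refine le_negLimitedSizeOver_of_retract (g := halfFn n kc r) (halfRetract hn2 hr)
    (fun y => sliceFn_comp_halfRetract hk hkn hr y) ?_ hlow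
  obtain ⟨C₀, hB₀, hC₀⟩ := exists_monotone_circuit (halfLang.sliceFn (halfLen n kc r))
    (monotone_sliceFn_halfLang hk hkn hr)
    (by rw [sliceFn_halfLang hk hkn hr]; exact halfSlice_false hk hkn.le (one_le_wOf hr hn2))
    (by rw [sliceFn_halfLang hk hkn hr]; exact halfSlice_true hk hkn.le (one_le_mCal (one_le_wOf hr hn2)))
  exact ⟨C₀, hB₀.mono monotoneBasis_subset_deMorgan,
    (Circuit.negationCount_eq_zero_of_isOver_monotoneBasis hB₀).le.trans (Nat.zero_le _), hC₀⟩

end Summit.PneNP.PneNP.Theorems.NegLimitedHalfWindow
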